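import Summits.Ventures.CertifiedManyBodySolver.Transport.TiltedAndersonCluster
import HarnessLib

/-!
# Ventures/CertifiedManyBodySolver — Transport/TiltedAndersonClusterChain.lean

HONEST FRAMING: first certified bounds; not a superconductivity verdict; every number certified or labelled float.

**The tilted-cluster correlator rows of the half-filled Hubbard chain** — companion of
`Transport/TiltedAndersonCluster.lean` (state-level soundness on all translation-invariant states), giving the
Venture predicates `ChainCorrUpperRow` / `ChainCorrLowerRow` (`Statement.lean` §S1: torus-limit half-filled
ground states `ω` of the even rings, energy hypothesis `hubbardChainEnergyDensity 1 U ≤ u` explicit) in the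
binder shape sr-mbsolver-m1-5 asked for (`LEVER-spintilt.md` §5 R3, sketch `tiltpre/lean/SpinTiltSketch.lean`):

* `chainSpinNN_upper_of_tiltedCluster` (**UPPER edge, ferromagnetic tilt `j < 0`**): for the window `[0, ℓ) ⊆ ℤ`
  with bond weights `w 0 … w (ℓ-2)`, site weights `v 0 … v (ℓ-1)` and spin-bond weights `w' 0 … w' (ℓ-2)`, each
  summing to `1`, a certified floor
  `tiltedAndersonCluster (halfOpenBox 1 ℓ) 1 U (chainBondWeights w) (chainSiteWeights v) j nnSupport1 spinDotNN1
   (chainSiteWeights w') - q·1 ⪰ 0` (= m1-5's `h_j(w,v,w') - q ⪰ 0` on the `4^ℓ`-dimensional Fock space,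
  `𝐒_b·𝐒_{b+1}` being the translate of the rows' word `spinDotNN1`, see `tiltWord_spinDotNN1_eq`) gives
  `ChainCorrUpperRow U u ((u - q)/|j|) nnSupport1 spinDotNN1`;
* `chainSpinNN_lower_of_tiltedCluster` (**LOWER edge, antiferromagnetic tilt `0 < j`**, the stoquastic side):
  `ChainCorrLowerRow U u ((q - u)/j) nnSupport1 spinDotNN1`;
* the same two rows for an ARBITRARY tilt word `X₀ ∈ 𝔄_{Λ₀}` (`chainCorrUpperRow_of_tiltedAndersonCluster`,
  `chainCorrLowerRow_of_tiltedAndersonCluster`; the effective tilt-weight sum is then the hypothesis `hw'`);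
* weakening helpers `chainCorrUpperRow_mono` / `chainCorrLowerRow_mono` and the instance-file shapes
  `chainSpinNN_upper_of_tiltedCluster_le` (`(u - q)/|j| ≤ b ⇒ ChainCorrUpperRow U u b …`) /
  `chainSpinNN_lower_of_tiltedCluster_le` (`b ≤ (q - u)/j ⇒ ChainCorrLowerRow U u b …`), `b` the booked rational.

§0 first records the two edges for EVERY translation-invariant state of density `1` with `e(ω) ≤ u` (any `d`,
any tilt word): `j < 0 ⇒ Re ω(X₀) ≤ (u - q)/|j|` (`IsTranslationInvariant.re_expect_le_of_tilt_neg`),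
`0 < j ⇒ (q - u)/j ≤ Re ω(X₀)` (`….le_re_expect_of_tilt_pos`).

PROOF of the rows. A torus-limit ground state of the rows is translation invariant (`IsTorusLimitOf.isTranslationInvariant`),
has density `1` (`IsTorusLimitOf.density_eq_one_of_ring`, from `IsTorusLimitOf.density_eq` with `N = L`) and
energy density `e(ω) = e₀(U)` (`IsTorusLimitOf.hubbardEnergyDensity_eq_hubbardChainEnergyDensity`, `U ≥ 0`);
apply `IsTranslationInvariant.re_expect_le_of_tilt_neg` / `….le_re_expect_of_tilt_pos` with the chain
coordinate sums of §1 (`siteWeightSum_halfOpenBox_one`, `bondWeightSum_halfOpenBox_one(_chainBondWeights)`,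
`tiltWeightSum_halfOpenBox_one_nnSupport1` — the substrate's private `…_chain` lemmas, re-proved). Until a tilt
certificate is REFEREE-SIGNED these theorems have no instance; a signed file `chain_l<ℓ>_tilt_U<U>_j<j>.json`
becomes a cell edge by ONE claim node `(tiltedAndersonCluster … - q·1).PosSemidef` and one `exact` (LEAD r116 (b)
label rule: hypothesis class = torus-limit class (I), as every signed `ChainCorr*Row`). Everything is proved;
no definition, no named fact, no sorry; axioms standard.

PRINTED SOURCE OF THE INEQUALITY. The device "bounds on a ground-state expectation value `⟨A⟩` from bounds on the
energies of the perturbed Hamiltonians `H + λA`" is E. H. Lieb, *The classical limit of quantum spin systems*,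
Commun. Math. Phys. 31 (1973) 327–340, §V eqs. (5.2)–(5.4): `λ⟨A⟩ ≥ f(λ) - f(0)` (Peierls–Bogoliubov), hence for
`λ > 0` `[f(0) - f(-λ)]/λ ≥ ⟨A⟩ ≥ [f(λ) - f(0)]/λ`, "and a bound similar to (5.4) holds for E [the ground-state energy].
This is merely the variational principle." Here `q` (a certified cluster floor of the tilted Hamiltonian, per site, in
the thermodynamic limit) plays `E(λ)` from below and `u` plays `E(0)` from above; the cluster floor itself is Anderson's
(Phys. Rev. 83 (1951) 1260, eq. (2)) with the weights of Valentí–Stolze–Hirschfeld (PRB 43 (1991) 13743, §II).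
[cite: Lieb1973, §V eq. (5.4)] [cite: Anderson1951, eq. (2)]
-/

noncomputable section

namespace Summit.Ventures.CertifiedManyBodySolver.Transport

open Matrix Finset Filter
open _root_.Topology
open Literature.Probability.LatticeModels
open Literature.MathematicalPhysics.QuantumLattice
open Literature.MathematicalPhysics.QuantumLattice.AndersonCluster
open Literature.MathematicalPhysics.QuantumLattice.ThermodynamicLimit
open HubbardWave0
open Summit.Ventures.CertifiedManyBodySolver.Certificates
open scoped ComplexOrder BigOperators

/-! ### §0. Correlator edges for translation-invariant states of density one (every `d`) -/

section Edges

variable {d : ℕ} {ω : InfVolFermionState d}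

/-- **UPPER correlator edge from a ferromagnetic-type tilt `j < 0`** (translation-invariant states of density
`1` satisfying the energy hypothesis `e(ω) ≤ u`): `Re ω(X₀) ≤ (u - q)/|j|`. -/
theorem _root_.Literature.MathematicalPhysics.QuantumLattice.InfVolFermionState.IsTranslationInvariant.re_expect_le_of_tilt_neg
    (hω : ω.IsTranslationInvariant) {Λ' : Finset (Site d)} {t U : ℝ} {w : Site d → Fin d → ℝ} {v : Site d → ℝ}
    {j : ℝ} {Λ₀ : Finset (Site d)} {X₀ : FermionOp Λ₀} {w' : Site d → ℝ} {q u : ℝ}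
    (hw : ∀ i, bondWeightSum Λ' w i = 1) (hv : siteWeightSum Λ' v = 1) (hw' : tiltWeightSum Λ' Λ₀ w' = 1)
    (hq : (tiltedAndersonCluster Λ' t U w v j Λ₀ X₀ w' - (q : ℂ) • (1 : FermionOp Λ')).PosSemidef)
    (hρ : ω.density = 1) (he : ω.hubbardEnergyDensity t U ≤ u) (hj : j < 0) :
    (ω.expect Λ₀ X₀).re ≤ (u - q) / |j| := by
  have h := hω.le_hubbardEnergyDensity_add_tilt hw hv hw' hq
  rw [hρ, sub_self, mul_zero, add_zero] at h
  rw [abs_of_neg hj, le_div_iff₀ (neg_pos.2 hj)]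
  nlinarith

/-- **LOWER correlator edge from an antiferromagnetic-type tilt `0 < j`** (translation-invariant states of
density `1` satisfying the energy hypothesis `e(ω) ≤ u`): `(q - u)/j ≤ Re ω(X₀)`. -/
theorem _root_.Literature.MathematicalPhysics.QuantumLattice.InfVolFermionState.IsTranslationInvariant.le_re_expect_of_tilt_pos
    (hω : ω.IsTranslationInvariant) {Λ' : Finset (Site d)} {t U : ℝ} {w : Site d → Fin d → ℝ} {v : Site d → ℝ}
    {j : ℝ} {Λ₀ : Finset (Site d)} {X₀ : FermionOp Λ₀} {w' : Site d → ℝ} {q u : ℝ}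
    (hw : ∀ i, bondWeightSum Λ' w i = 1) (hv : siteWeightSum Λ' v = 1) (hw' : tiltWeightSum Λ' Λ₀ w' = 1)
    (hq : (tiltedAndersonCluster Λ' t U w v j Λ₀ X₀ w' - (q : ℂ) • (1 : FermionOp Λ')).PosSemidef)
    (hρ : ω.density = 1) (he : ω.hubbardEnergyDensity t U ≤ u) (hj : 0 < j) :
    (q - u) / j ≤ (ω.expect Λ₀ X₀).re := by
  have h := hω.le_hubbardEnergyDensity_add_tilt hw hv hw' hq
  rw [hρ, sub_self, mul_zero, add_zero] at h
  rw [div_le_iff₀ hj]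
  nlinarith

end Edges

/-! ### §1. Chain coordinates: the window `[0, ℓ) ⊆ ℤ`, weights indexed by `ℕ` -/

section ChainCoordinates

/-- `Σ_{x ∈ [0,ℓ)} v (x 0) = Σ_{j < ℓ} v j` (the substrate's private `siteWeightSum_chain`, re-proved). -/
theorem siteWeightSum_halfOpenBox_one (ℓ : ℕ) (v : ℕ → ℝ) :
    siteWeightSum (halfOpenBox 1 ℓ) (chainSiteWeights v) = ∑ j ∈ Finset.range ℓ, v j := by
  unfold siteWeightSum chainSiteWeights
  refine Finset.sum_nbij' (fun x => (x 0).toNat) (fun j => fun _ => (j : ℤ)) ?_ ?_ ?_ ?_ ?_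
  · intro x hx
    have := (mem_halfOpenBox.1 (Finset.mem_coe.1 hx)) 0
    exact Finset.mem_range.2 (by omega)
  · intro j hj
    have hj' := Finset.mem_range.1 (Finset.mem_coe.1 hj)
    exact Finset.mem_coe.2 (mem_halfOpenBox.2 fun _ => ⟨by positivity, by exact_mod_cast hj'⟩)
  · intro x hx
    have := (mem_halfOpenBox.1 (Finset.mem_coe.1 hx)) 0
    funext i
    rw [Fin.fin_one_eq_zero i]
    exact Int.toNat_of_nonneg this.1
  · intro j _
    simp
  · intro x _
    rfl

/-- `Σ_{x ∈ [0,ℓ), x+1 ∈ [0,ℓ)} J x 0 = Σ_{j < ℓ-1} w j` for `J x 0 = w (x 0)` (the substrate's private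
`bondWeightSum_chain`, re-proved for any direction-independent reading of the weights). -/
theorem bondWeightSum_halfOpenBox_one (ℓ : ℕ) (w : ℕ → ℝ) (J : Site 1 → Fin 1 → ℝ)
    (hJ : ∀ x i, J x i = w (x 0).toNat) :
    bondWeightSum (halfOpenBox 1 ℓ) J 0 = ∑ j ∈ Finset.range (ℓ - 1), w j := by
  have h1 : bondWeightSum (halfOpenBox 1 ℓ) J 0 =
      ∑ j ∈ Finset.range ℓ, if j + 1 < ℓ then w j else 0 := by
    unfold bondWeightSum AndersonCluster.bondWeight
    simp_rw [hJ]
    refine Finset.sum_nbij' (fun x => (x 0).toNat) (fun j => fun _ => (j : ℤ)) ?_ ?_ ?_ ?_ ?_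
    · intro x hx
      have := (mem_halfOpenBox.1 (Finset.mem_coe.1 hx)) 0
      exact Finset.mem_range.2 (by omega)
    · intro j hj
      have hj' := Finset.mem_range.1 (Finset.mem_coe.1 hj)
      exact Finset.mem_coe.2 (mem_halfOpenBox.2 fun _ => ⟨by positivity, by exact_mod_cast hj'⟩)
    · intro x hx
      have := (mem_halfOpenBox.1 (Finset.mem_coe.1 hx)) 0
      funext i
      rw [Fin.fin_one_eq_zero i]
      exact Int.toNat_of_nonneg this.1
    · intro j _
      simp
    · intro x hx
      have hx0 := (mem_halfOpenBox.1 (Finset.mem_coe.1 hx)) 0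
      have hiff : x + unitVec 0 ∈ halfOpenBox 1 ℓ ↔ (x 0).toNat + 1 < ℓ := by
        rw [mem_halfOpenBox, Fin.forall_fin_one]
        simp only [Pi.add_apply, unitVec, Pi.single_eq_same]
        omega
      by_cases hc : (x 0).toNat + 1 < ℓ
      · rw [if_pos (hiff.2 hc), if_pos hc]
      · rw [if_neg (fun h => hc (hiff.1 h)), if_neg hc]
  rw [h1]
  cases ℓ with
  | zero => simp
  | succ k =>
    rw [Finset.sum_range_succ, if_neg (by omega), add_zero, Nat.add_sub_cancel]
    exact Finset.sum_congr rfl fun j hj => by rw [if_pos (by have := Finset.mem_range.1 hj; omega)]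

/-- The chain bond weights: `Σ_{j < ℓ-1} w j` over the window `[0, ℓ)`. -/
theorem bondWeightSum_halfOpenBox_one_chainBondWeights (ℓ : ℕ) (w : ℕ → ℝ) :
    bondWeightSum (halfOpenBox 1 ℓ) (chainBondWeights w) 0 = ∑ j ∈ Finset.range (ℓ - 1), w j :=
  bondWeightSum_halfOpenBox_one ℓ w _ fun _ _ => rfl

/-- The translate `{y, y + e₁}` of the two-site support `nnSupport1 = {0, e₁}` fits into `Λ'` iff both
endpoints do. -/
theorem shiftSet_nnSupport1_subset_iff {Λ' : Finset (Site 1)} {y : Site 1} :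
    shiftSet y nnSupport1 ⊆ Λ' ↔ y ∈ Λ' ∧ y + unitVec 0 ∈ Λ' := by
  constructor
  · intro h
    refine ⟨h (mem_shiftSet.2 ?_), h (mem_shiftSet.2 ?_)⟩
    · rw [sub_self]; exact zero_mem_nnSupport1
    · rw [add_sub_cancel_left]; exact e1_mem_nnSupport1
  · rintro ⟨h0, h1⟩ x hx
    rw [mem_shiftSet, Finset.mem_insert, Finset.mem_singleton] at hx
    rcases hx with hx | hx
    · rw [sub_eq_zero] at hx; rw [hx]; exact h0
    · rw [sub_eq_iff_eq_add] at hx; rw [hx, add_comm]; exact h1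

/-- **The placed spin word is the explicit `𝐒_y·𝐒_{y+e₁}`.** For a window site `y` with `y + e₁ ∈ Λ'` the tilt
word `Γ(τ_y) spinDotNN1` is the sum of the six normal-ordered words of `spinDotNN1` with `c_{0σ} ↦ c_{yσ}`,
`c_{e₁σ} ↦ c_{y+e₁,σ}` — m1-5's `clusterSpinDot`, i.e. literally the `𝐒_b·𝐒_{b+1}` matrix a tilt certificate's
builder writes down (`S⁺ = c†_↑ c_↓`, `S^z = (n_↑ - n_↓)/2`; FORMAT-mcert1 / LEVER-spintilt §1, §4). -/
theorem tiltWord_spinDotNN1_eq {Λ' : Finset (Site 1)} {y : Site 1} (hy : y ∈ Λ') (h : y + unitVec 0 ∈ Λ') :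
    tiltWord Λ' nnSupport1 spinDotNN1 y =
      ((1/4 : ℚ) : ℂ) • ((cAt y hy 0)ᴴ * (cAt (y + unitVec 0) h 0)ᴴ * cAt (y + unitVec 0) h 0 * cAt y hy 0) +
      ((1/2 : ℚ) : ℂ) • ((cAt y hy 0)ᴴ * (cAt (y + unitVec 0) h 1)ᴴ * cAt (y + unitVec 0) h 0 * cAt y hy 1) +
      ((-1/4 : ℚ) : ℂ) • ((cAt y hy 0)ᴴ * (cAt (y + unitVec 0) h 1)ᴴ * cAt (y + unitVec 0) h 1 * cAt y hy 0) +
      ((-1/4 : ℚ) : ℂ) • ((cAt y hy 1)ᴴ * (cAt (y + unitVec 0) h 0)ᴴ * cAt (y + unitVec 0) h 0 * cAt y hy 1) +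
      ((1/2 : ℚ) : ℂ) • ((cAt y hy 1)ᴴ * (cAt (y + unitVec 0) h 0)ᴴ * cAt (y + unitVec 0) h 1 * cAt y hy 0) +
      ((1/4 : ℚ) : ℂ) • ((cAt y hy 1)ᴴ * (cAt (y + unitVec 0) h 1)ᴴ * cAt (y + unitVec 0) h 1 * cAt y hy 1) := by
  have hsub : shiftSet y nnSupport1 ⊆ Λ' := shiftSet_nnSupport1_subset_iff.2 ⟨hy, h⟩
  have h0 : ∀ σ, fermionEmbed (placeEmb Λ' nnSupport1 y hsub) (cNN1 0 σ) = cAt y hy σ := fun σ => by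
    show fermionEmbed _ (cAt 0 zero_mem_nnSupport1 σ) = _
    rw [cAt, fermionEmbed_annihilation, placeEmb_pt]
    exact cAt_congr _ _ (zero_add y) σ
  have h1 : ∀ σ, fermionEmbed (placeEmb Λ' nnSupport1 y hsub) (cNN1 1 σ) = cAt (y + unitVec 0) h σ := fun σ => by
    show fermionEmbed _ (cAt (unitVec 0) e1_mem_nnSupport1 σ) = _
    rw [cAt, fermionEmbed_annihilation, placeEmb_pt]
    exact cAt_congr _ _ (add_comm _ _) σ
  rw [tiltWord, dif_pos hsub, spinDotNN1]
  simp only [fermionEmbed_add, fermionEmbed_smul, fermionEmbed_mul, fermionEmbed_conjTranspose, h0, h1]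

/-- For the nearest-neighbour support the effective tilt weight of a window site is its bond weight. -/
theorem tiltWeight_nnSupport1 (Λ' : Finset (Site 1)) (w' : Site 1 → ℝ) {y : Site 1} (hy : y ∈ Λ') :
    tiltWeight Λ' nnSupport1 w' y = bondWeight Λ' (fun x _ => w' x) y 0 := by
  unfold tiltWeight AndersonCluster.bondWeight
  by_cases h : y + unitVec 0 ∈ Λ'
  · rw [if_pos (shiftSet_nnSupport1_subset_iff.2 ⟨hy, h⟩), if_pos h]
  · rw [if_neg (fun h' => h (shiftSet_nnSupport1_subset_iff.1 h').2), if_neg h]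

/-- For the nearest-neighbour support the total effective tilt weight is the total bond weight. -/
theorem tiltWeightSum_nnSupport1 (Λ' : Finset (Site 1)) (w' : Site 1 → ℝ) :
    tiltWeightSum Λ' nnSupport1 w' = bondWeightSum Λ' (fun x _ => w' x) 0 := by
  unfold tiltWeightSum bondWeightSum
  exact Finset.sum_congr rfl fun y hy => tiltWeight_nnSupport1 Λ' w' hy

/-- The spin-bond weights of the chain cluster: `Σ_{b < ℓ-1} w' b` over the window `[0, ℓ)`
(`w' b` = weight of the spin bond `(b, b+1)`). -/
theorem tiltWeightSum_halfOpenBox_one_nnSupport1 (ℓ : ℕ) (w' : ℕ → ℝ) :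
    tiltWeightSum (halfOpenBox 1 ℓ) nnSupport1 (chainSiteWeights w') = ∑ b ∈ Finset.range (ℓ - 1), w' b := by
  rw [tiltWeightSum_nnSupport1]
  exact bondWeightSum_halfOpenBox_one ℓ w' _ fun _ _ => rfl

end ChainCoordinates

/-! ### §2. Torus-limit ground states of the half-filled chain have density one -/

section TorusLimit

/-- **A torus limit of `L`-particle unit vectors of the rings `ℤ/Lℤ` along `L → ∞` has density `1`.** -/
theorem _root_.Literature.MathematicalPhysics.QuantumLattice.InfVolFermionState.IsTorusLimitOf.density_eq_one_of_ring
    {ω : InfVolFermionState 1} {ψ : ∀ L, Fock (Orb (FermionTorus 1 L))} {Ls : ℕ → ℕ}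
    (hlim : ω.IsTorusLimitOf ψ Ls) (hLs : Tendsto Ls atTop atTop) {t U : ℝ}
    (hψ : ∀ j, _root_.Literature.MathematicalPhysics.QuantumLattice.IsGroundState
      (hamiltonian (fermionTorusGraph 1 (Ls j)) t U) (Ls j) (ψ (Ls j)))
    (hψ1 : ∀ j, star (ψ (Ls j)) ⬝ᵥ ψ (Ls j) = 1) : ω.density = 1 := by
  refine hlim.density_eq hLs (N := Ls) (fun j => (hψ j).1) hψ1 ?_
  refine tendsto_const_nhds.congr' ?_
  filter_upwards [hLs.eventually_ge_atTop 1] with j hj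
  have h0 : ((Ls j : ℕ) : ℝ) ≠ 0 := by exact_mod_cast (show Ls j ≠ 0 by omega)
  rw [pow_one, div_self h0]

end TorusLimit

/-! ### §3. The tilted-cluster correlator rows of the half-filled chain -/

section Rows

/-- Weakening an UPPER correlator row: `Re ω(X) ≤ q ≤ q'` (for instance files: round the edge `(u - q)/|j|`
OUTWARD to the booked rational). -/
theorem chainCorrUpperRow_mono {U : ℝ} {u q q' : ℚ} {Λ : Finset (Site 1)} {X : FermionOp Λ}
    (h : ChainCorrUpperRow U u q Λ X) (hq : q ≤ q') : ChainCorrUpperRow U u q' Λ X :=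
  fun ω Ls ψ h1 h2 h3 h4 h5 h6 => (h ω Ls ψ h1 h2 h3 h4 h5 h6).trans (by exact_mod_cast hq)

/-- Weakening a LOWER correlator row: `q' ≤ q ≤ Re ω(X)`. -/
theorem chainCorrLowerRow_mono {U : ℝ} {u q q' : ℚ} {Λ : Finset (Site 1)} {X : FermionOp Λ}
    (h : ChainCorrLowerRow U u q Λ X) (hq : q' ≤ q) : ChainCorrLowerRow U u q' Λ X :=
  fun ω Ls ψ h1 h2 h3 h4 h5 h6 => le_trans (by exact_mod_cast hq) (h ω Ls ψ h1 h2 h3 h4 h5 h6)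

/-- **UPPER correlator edge of the half-filled chain from a tilted open cluster with `j < 0`** (generic tilt
word `X₀` on `Λ₀ ⊆ ℤ`): a certified floor `h_j - q·1 ⪰ 0` on the `4^ℓ`-dimensional Fock space of the window
`[0, ℓ)`, with `Σ_{b<ℓ-1} w b = Σ_{x<ℓ} v x = 1` and unit effective tilt weight, gives the Venture row
`ChainCorrUpperRow U u ((u - q)/|j|) Λ₀ X₀`: for every torus-limit half-filled ground state `ω` of the chain
with `e₀(U) ≤ u`, `Re ω(X₀) ≤ (u - q)/|j|`. -/
theorem chainCorrUpperRow_of_tiltedAndersonCluster {U : ℝ} (hU : 0 ≤ U) {ℓ : ℕ} {w v w' : ℕ → ℝ}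
    {Λ₀ : Finset (Site 1)} {X₀ : FermionOp Λ₀} {j q : ℚ} (u : ℚ) (hj : j < 0)
    (hw : ∑ b ∈ Finset.range (ℓ - 1), w b = 1) (hv : ∑ x ∈ Finset.range ℓ, v x = 1)
    (hw' : tiltWeightSum (halfOpenBox 1 ℓ) Λ₀ (chainSiteWeights w') = 1)
    (hq : (tiltedAndersonCluster (halfOpenBox 1 ℓ) 1 U (chainBondWeights w) (chainSiteWeights v) (j : ℝ) Λ₀ X₀
      (chainSiteWeights w') - ((q : ℝ) : ℂ) • (1 : FermionOp (halfOpenBox 1 ℓ))).PosSemidef) :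
    ChainCorrUpperRow U u ((u - q) / |j|) Λ₀ X₀ := by
  intro ω Ls ψ hLs _hev hψ hψ1 hlim hu
  have hω := hlim.isTranslationInvariant
  have hρ := hlim.density_eq_one_of_ring hLs hψ hψ1
  have he : ω.hubbardEnergyDensity 1 U ≤ ((u : ℚ) : ℝ) := by
    rw [hlim.hubbardEnergyDensity_eq_hubbardChainEnergyDensity hLs 1 hU hψ hψ1]; exact hu
  have h := hω.re_expect_le_of_tilt_neg (t := 1)
    (fun i => by rw [Fin.fin_one_eq_zero i, bondWeightSum_halfOpenBox_one_chainBondWeights]; exact hw)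
    (by rw [siteWeightSum_halfOpenBox_one]; exact hv) hw' hq hρ he (by exact_mod_cast hj)
  push_cast
  exact h

/-- **LOWER correlator edge of the half-filled chain from a tilted open cluster with `0 < j`** (generic tilt
word): `ChainCorrLowerRow U u ((q - u)/j) Λ₀ X₀`. -/
theorem chainCorrLowerRow_of_tiltedAndersonCluster {U : ℝ} (hU : 0 ≤ U) {ℓ : ℕ} {w v w' : ℕ → ℝ}
    {Λ₀ : Finset (Site 1)} {X₀ : FermionOp Λ₀} {j q : ℚ} (u : ℚ) (hj : 0 < j)
    (hw : ∑ b ∈ Finset.range (ℓ - 1), w b = 1) (hv : ∑ x ∈ Finset.range ℓ, v x = 1)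
    (hw' : tiltWeightSum (halfOpenBox 1 ℓ) Λ₀ (chainSiteWeights w') = 1)
    (hq : (tiltedAndersonCluster (halfOpenBox 1 ℓ) 1 U (chainBondWeights w) (chainSiteWeights v) (j : ℝ) Λ₀ X₀
      (chainSiteWeights w') - ((q : ℝ) : ℂ) • (1 : FermionOp (halfOpenBox 1 ℓ))).PosSemidef) :
    ChainCorrLowerRow U u ((q - u) / j) Λ₀ X₀ := by
  intro ω Ls ψ hLs _hev hψ hψ1 hlim hu
  have hω := hlim.isTranslationInvariant
  have hρ := hlim.density_eq_one_of_ring hLs hψ hψ1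
  have he : ω.hubbardEnergyDensity 1 U ≤ ((u : ℚ) : ℝ) := by
    rw [hlim.hubbardEnergyDensity_eq_hubbardChainEnergyDensity hLs 1 hU hψ hψ1]; exact hu
  have h := hω.le_re_expect_of_tilt_pos (t := 1)
    (fun i => by rw [Fin.fin_one_eq_zero i, bondWeightSum_halfOpenBox_one_chainBondWeights]; exact hw)
    (by rw [siteWeightSum_halfOpenBox_one]; exact hv) hw' hq hρ he (by exact_mod_cast hj)
  push_cast
  exact h

/-- **R3 (m1-5 LEVER-spintilt §5), UPPER edge: the spin-tilted Anderson cluster with a ferromagnetic tilt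
`j < 0` bounds the nearest-neighbour spin correlation of the half-filled chain from ABOVE** (Lieb's (5.4) with a
cluster floor of the tilted Hamiltonian [cite: Lieb1973, §V eq. (5.4)]). With
`h_j(w,v,w') = h(w,v) + j Σ_{b<ℓ-1} w' b · 𝐒_b·𝐒_{b+1}` on the open cluster `[0, ℓ)` (`𝐒_b·𝐒_{b+1}` = the
translate of the rows' word `spinDotNN1`), `Σ w = Σ v = Σ w' = 1` and a certified floor `h_j - q·1 ⪰ 0`:
`ChainCorrUpperRow U u ((u - q)/|j|) nnSupport1 spinDotNN1`. -/
theorem chainSpinNN_upper_of_tiltedCluster {U : ℝ} (hU : 0 ≤ U) {ℓ : ℕ} {w v w' : ℕ → ℝ} {j q : ℚ} (u : ℚ)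
    (hj : j < 0) (hw : ∑ b ∈ Finset.range (ℓ - 1), w b = 1) (hv : ∑ x ∈ Finset.range ℓ, v x = 1)
    (hw' : ∑ b ∈ Finset.range (ℓ - 1), w' b = 1)
    (hq : (tiltedAndersonCluster (halfOpenBox 1 ℓ) 1 U (chainBondWeights w) (chainSiteWeights v) (j : ℝ)
      nnSupport1 spinDotNN1 (chainSiteWeights w') -
        ((q : ℝ) : ℂ) • (1 : FermionOp (halfOpenBox 1 ℓ))).PosSemidef) :
    ChainCorrUpperRow U u ((u - q) / |j|) nnSupport1 spinDotNN1 :=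
  chainCorrUpperRow_of_tiltedAndersonCluster hU u hj hw hv
    (by rw [tiltWeightSum_halfOpenBox_one_nnSupport1]; exact hw') hq

/-- **R3, LOWER edge: an antiferromagnetic tilt `0 < j` bounds the nearest-neighbour spin correlation from
BELOW** (the stoquastic side: M-matrix / positive-vector certificates apply to `h_j`) [cite: Lieb1973, §V eq. (5.4)]:
`ChainCorrLowerRow U u ((q - u)/j) nnSupport1 spinDotNN1`. -/
theorem chainSpinNN_lower_of_tiltedCluster {U : ℝ} (hU : 0 ≤ U) {ℓ : ℕ} {w v w' : ℕ → ℝ} {j q : ℚ} (u : ℚ)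
    (hj : 0 < j) (hw : ∑ b ∈ Finset.range (ℓ - 1), w b = 1) (hv : ∑ x ∈ Finset.range ℓ, v x = 1)
    (hw' : ∑ b ∈ Finset.range (ℓ - 1), w' b = 1)
    (hq : (tiltedAndersonCluster (halfOpenBox 1 ℓ) 1 U (chainBondWeights w) (chainSiteWeights v) (j : ℝ)
      nnSupport1 spinDotNN1 (chainSiteWeights w') -
        ((q : ℝ) : ℂ) • (1 : FermionOp (halfOpenBox 1 ℓ))).PosSemidef) :
    ChainCorrLowerRow U u ((q - u) / j) nnSupport1 spinDotNN1 :=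
  chainCorrLowerRow_of_tiltedAndersonCluster hU u hj hw hv
    (by rw [tiltWeightSum_halfOpenBox_one_nnSupport1]; exact hw') hq

/-- `chainSpinNN_upper_of_tiltedCluster` with the edge rounded outward to a booked rational `b ≥ (u - q)/|j|`
(the shape an instance file states literally). -/
theorem chainSpinNN_upper_of_tiltedCluster_le {U : ℝ} (hU : 0 ≤ U) {ℓ : ℕ} {w v w' : ℕ → ℝ} {j q : ℚ}
    (u b : ℚ) (hj : j < 0) (hb : (u - q) / |j| ≤ b)
    (hw : ∑ b ∈ Finset.range (ℓ - 1), w b = 1) (hv : ∑ x ∈ Finset.range ℓ, v x = 1)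
    (hw' : ∑ b ∈ Finset.range (ℓ - 1), w' b = 1)
    (hq : (tiltedAndersonCluster (halfOpenBox 1 ℓ) 1 U (chainBondWeights w) (chainSiteWeights v) (j : ℝ)
      nnSupport1 spinDotNN1 (chainSiteWeights w') -
        ((q : ℝ) : ℂ) • (1 : FermionOp (halfOpenBox 1 ℓ))).PosSemidef) :
    ChainCorrUpperRow U u b nnSupport1 spinDotNN1 :=
  chainCorrUpperRow_mono (chainSpinNN_upper_of_tiltedCluster hU u hj hw hv hw' hq) hb

/-- `chainSpinNN_lower_of_tiltedCluster` with the edge rounded outward to a booked rational `b ≤ (q - u)/j`. -/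
theorem chainSpinNN_lower_of_tiltedCluster_le {U : ℝ} (hU : 0 ≤ U) {ℓ : ℕ} {w v w' : ℕ → ℝ} {j q : ℚ}
    (u b : ℚ) (hj : 0 < j) (hb : b ≤ (q - u) / j)
    (hw : ∑ b ∈ Finset.range (ℓ - 1), w b = 1) (hv : ∑ x ∈ Finset.range ℓ, v x = 1)
    (hw' : ∑ b ∈ Finset.range (ℓ - 1), w' b = 1)
    (hq : (tiltedAndersonCluster (halfOpenBox 1 ℓ) 1 U (chainBondWeights w) (chainSiteWeights v) (j : ℝ)
      nnSupport1 spinDotNN1 (chainSiteWeights w') -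
        ((q : ℝ) : ℂ) • (1 : FermionOp (halfOpenBox 1 ℓ))).PosSemidef) :
    ChainCorrLowerRow U u b nnSupport1 spinDotNN1 :=
  chainCorrLowerRow_mono (chainSpinNN_lower_of_tiltedCluster hU u hj hw hv hw' hq) hb

end Rows

end Summit.Ventures.CertifiedManyBodySolver.Transport

end
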